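import Mathlib
import HarnessLib
import Summits.HubbardSuperconductivity.HubbardSuperconductivity.Theorems.KLProgrammeC4aPPKernelTrueSignedDeriv

/-!
# Route `KLProgramme` — crux C4a, S3 brick (B4) «(B4)-UMK1», «(M1)-TRUE-KERNEL» for the (U1)-LAWS INTERFACE: the smooth PRODUCT FORM of the signed pp kernel
# `P(e,u) = (2/β)Σ W(ωₙ,e)W(ωₙ,u)(eu+ωₙ²)/((ωₙ²+e²)(ωₙ²+u²))` — `P·(e+u) = N`, `C¹` in `u`, and the envelopes `hK0`/`hK1` at EVERY signed partner level

Cell `gate-hubbard-kl`, seat hubbard-kl-k3c3-p1 (g15; row «δμ-flow with klAngularMean constant piece»).  Closes the recipe of memo `M1-TRUE-KERNEL.md` §8: a CONCRETE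
`C¹` function of the partner level for the (U1)-LAWS slot `K e` (`…C4aFoldBoxTwoSidedLaw`, hypotheses `hK`, `hK0`, `hK1`), equal to `N(e,u)/(e+u)` off the single point
`u = −e` and smooth through it.
* §1 def `ppTrueKernel` (`P`), `abs_pairSummand_core_le` (`|eu+ω²|/((ω²+e²)(ω²+u²)) ≤ 1/(ω²+u²) + 1/(ω²+e²)`), `summable_ppTrueKernel`,
  **`ppTrueKernel_mul`** (`P(e,u)·(e+u) = N(e,u)`), `ppTrueKernel_eq_div` (`e+u ≠ 0 ⟹ P = N/(e+u)`), `continuous_ppTrueKernel_u`;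
* §2 def `ppTrueKernelDu`, **`hasDerivAt_ppTrueKernel_u`** (termwise), `continuous_ppTrueKernelDu_u`, **`contDiff_one_ppTrueKernel`** (`u ↦ P(e,u)` is `C¹`),
  `ppTrueKernelDu_eq_of_ne` (`e+u ≠ 0 ⟹ ∂ᵤP = ∂ᵤN/(e+u) − N/(e+u)²`);
* §3 **`abs_ppTrueKernel_le_inv_max`** (`0<e ⟹ |P(e,u)| ≤ (12B₁+9)·(max e |u|)⁻¹` for EVERY `u`, the point `u=−e` by continuity),
  **`abs_ppTrueKernelDu_le_inv_max_sq`** (`0<e`, `0<c≤1`, `c·e ≤ |u|` ⟹ `|∂ᵤP(e,u)| ≤ (64B₂+96B₁+136+(12B₁+9)/c)·(max e |u|)⁻¹²` for EVERY such `u`, the point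
  `u = −e` by continuity from the left).
So the closer's `K e := P(e,·)·κ-split` has `hK` (C¹), and `hK0`/`hK1` follow from these plus the split's own size (`|κ| ≤ κ₀`, `|κ′| ≤ κ₁`).
Pure real analysis; nothing asserts (C), K3 or superconductivity.
References: BGM 2006 §2.1 (2.3), §2.4 (2.36) [cite: BenfattoGiulianiMastropietro2006]; Salmhofer 1999 §4.2.5 [cite: Salmhofer1999].
-/

noncomputable section

namespace Summit.HubbardSuperconductivity.HubbardSuperconductivity.Theorems.C4a

set_option linter.dupNamespace false -- summit = problem name (single-conjunct summit), D-0017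

open Real Filter Set
open scoped Topology
open Literature.MathematicalPhysics.QuantumLattice Literature.Analysis.SpecialFunctions

/-! ## §1 The product form -/

/-- **The signed pp kernel in product form**: `P(e,u) = (2/β)Σₙ W(ωₙ,e)W(ωₙ,u)·(eu+ωₙ²)/((ωₙ²+e²)(ωₙ²+u²))`
(`= (1/β)Σ_{±ωₙ} Ψ̂(ωₙ,e)Ψ̂(−ωₙ,u)`, real part paired). -/
def ppTrueKernel (β Λ e u : ℝ) : ℝ :=
  2 / β * ∑' n : ℕ, uvWeightFn Λ (ppFreq β n) e * uvWeightFn Λ (ppFreq β n) u * ((e * u + ppFreq β n ^ 2) / ((ppFreq β n ^ 2 + e ^ 2) * (ppFreq β n ^ 2 + u ^ 2)))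

/-- The core algebraic majorant `|eu+ω²|/((ω²+e²)(ω²+u²)) ≤ 1/(ω²+u²) + 1/(ω²+e²)` (`ω ≠ 0`). [folklore] -/
theorem abs_pairSummand_core_le {ω : ℝ} (hω : ω ≠ 0) (e u : ℝ) :
    |(e * u + ω ^ 2) / ((ω ^ 2 + e ^ 2) * (ω ^ 2 + u ^ 2))| ≤ 1 / (ω ^ 2 + u ^ 2) + 1 / (ω ^ 2 + e ^ 2) := by
  have h1 : 0 < ω ^ 2 + e ^ 2 := by positivity
  have h2 : 0 < ω ^ 2 + u ^ 2 := by positivity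
  rw [abs_div, abs_of_pos (mul_pos h1 h2), div_add_div _ _ h2.ne' h1.ne', div_le_div_iff₀ (mul_pos h1 h2) (mul_pos h2 h1)]
  have h3 : |e * u + ω ^ 2| ≤ (ω ^ 2 + e ^ 2) + (ω ^ 2 + u ^ 2) := by
    rw [abs_le]; constructor <;> nlinarith [sq_nonneg (e + u), sq_nonneg (e - u), sq_nonneg ω]
  calc |e * u + ω ^ 2| * ((ω ^ 2 + u ^ 2) * (ω ^ 2 + e ^ 2)) ≤ ((ω ^ 2 + e ^ 2) + (ω ^ 2 + u ^ 2)) * ((ω ^ 2 + u ^ 2) * (ω ^ 2 + e ^ 2)) := by gcongr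
    _ = _ := by ring

/-- The summand of `P` is dominated by `2/ωₙ²`, uniformly in the levels. [folklore] -/
theorem abs_ppTrueKernel_summand_le {β : ℝ} (hβ : 0 < β) (Λ e u : ℝ) (n : ℕ) :
    |uvWeightFn Λ (ppFreq β n) e * uvWeightFn Λ (ppFreq β n) u * ((e * u + ppFreq β n ^ 2) / ((ppFreq β n ^ 2 + e ^ 2) * (ppFreq β n ^ 2 + u ^ 2)))| ≤
      2 * (1 / (ppFreq β n ^ 2 + 0 ^ 2)) := by
  have hω := ppFreq_pos hβ n
  have hc := abs_pairSummand_core_le hω.ne' e u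
  have h1 : 1 / (ppFreq β n ^ 2 + u ^ 2) ≤ 1 / (ppFreq β n ^ 2 + 0 ^ 2) := one_div_le_one_div_of_le (by positivity) (by nlinarith [sq_nonneg u])
  have h2 : 1 / (ppFreq β n ^ 2 + e ^ 2) ≤ 1 / (ppFreq β n ^ 2 + 0 ^ 2) := one_div_le_one_div_of_le (by positivity) (by nlinarith [sq_nonneg e])
  rw [abs_mul, abs_mul]
  calc |uvWeightFn Λ (ppFreq β n) e| * |uvWeightFn Λ (ppFreq β n) u| * |(e * u + ppFreq β n ^ 2) / ((ppFreq β n ^ 2 + e ^ 2) * (ppFreq β n ^ 2 + u ^ 2))|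
      ≤ 1 * 1 * (1 / (ppFreq β n ^ 2 + u ^ 2) + 1 / (ppFreq β n ^ 2 + e ^ 2)) := by
        gcongr
        · exact abs_uvWeightFn_le_one _ _ _
        · exact abs_uvWeightFn_le_one _ _ _
    _ ≤ 2 * (1 / (ppFreq β n ^ 2 + 0 ^ 2)) := by linarith

/-- `P`'s series is summable. [folklore] -/
theorem summable_ppTrueKernel {β : ℝ} (hβ : 0 < β) (Λ e u : ℝ) :
    Summable fun n : ℕ => uvWeightFn Λ (ppFreq β n) e * uvWeightFn Λ (ppFreq β n) u * ((e * u + ppFreq β n ^ 2) / ((ppFreq β n ^ 2 + e ^ 2) * (ppFreq β n ^ 2 + u ^ 2))) :=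
  Summable.of_norm_bounded ((summable_one_div_ppFreq_sq_add_sq hβ 0).mul_left 2) fun n => by
    rw [Real.norm_eq_abs]; exact abs_ppTrueKernel_summand_le hβ Λ e u n

/-- **`P(e,u)·(e+u) = N(e,u)`** (`(eu+ω²)(e+u) = e(ω²+u²) + u(ω²+e²)`). [cite: BenfattoGiulianiMastropietro2006, §2.1 (2.3)] -/
theorem ppTrueKernel_mul {β : ℝ} (hβ : 0 < β) (Λ e u : ℝ) : ppTrueKernel β Λ e u * (e + u) = ppTrueNumerator β Λ e u := by
  unfold ppTrueKernel ppTrueNumerator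
  rw [mul_assoc, mul_comm (∑' n : ℕ, _) (e + u), ← tsum_mul_left]
  congr 1
  refine tsum_congr fun n => ?_
  have hω := ppFreq_pos hβ n
  have h1 : ppFreq β n ^ 2 + e ^ 2 ≠ 0 := by positivity
  have h2 : ppFreq β n ^ 2 + u ^ 2 ≠ 0 := by positivity
  field_simp
  ring

/-- Off the anti-diagonal `P = N/(e+u)`. [cite: BenfattoGiulianiMastropietro2006, §2.1 (2.3)] -/
theorem ppTrueKernel_eq_div {β : ℝ} (hβ : 0 < β) (Λ : ℝ) {e u : ℝ} (hs : e + u ≠ 0) : ppTrueKernel β Λ e u = ppTrueNumerator β Λ e u / (e + u) := by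
  rw [← ppTrueKernel_mul hβ Λ e u, mul_div_cancel_right₀ _ hs]

/-- `u ↦ P(e,u)` is continuous. [cite: BenfattoGiulianiMastropietro2006, §2.1 (2.3)] -/
theorem continuous_ppTrueKernel_u {β : ℝ} (hβ : 0 < β) (Λ e : ℝ) : Continuous fun u : ℝ => ppTrueKernel β Λ e u := by
  unfold ppTrueKernel
  refine continuous_const.mul ?_
  refine continuous_tsum (fun n => ?_) ((summable_one_div_ppFreq_sq_add_sq hβ 0).mul_left 2) fun n u => ?_
  · have hω := ppFreq_pos hβ n
    have hW : Continuous fun u : ℝ => uvWeightFn Λ (ppFreq β n) u := continuous_uvWeightFn_level Λ _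
    have hne : ∀ u : ℝ, (ppFreq β n ^ 2 + e ^ 2) * (ppFreq β n ^ 2 + u ^ 2) ≠ 0 := fun u => by positivity
    have h1 : Continuous fun u : ℝ => (e * u + ppFreq β n ^ 2) / ((ppFreq β n ^ 2 + e ^ 2) * (ppFreq β n ^ 2 + u ^ 2)) :=
      Continuous.div (by fun_prop) (by fun_prop) hne
    have h2 : Continuous fun u : ℝ => uvWeightFn Λ (ppFreq β n) e * uvWeightFn Λ (ppFreq β n) u *
        ((e * u + ppFreq β n ^ 2) / ((ppFreq β n ^ 2 + e ^ 2) * (ppFreq β n ^ 2 + u ^ 2))) := (continuous_const.mul hW).mul h1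
    exact h2
  · rw [Real.norm_eq_abs]; exact abs_ppTrueKernel_summand_le hβ Λ e u n

/-! ## §2 Differentiability: `u ↦ P(e,u)` is `C¹` -/

/-- `∂ᵤP = (2/β)Σ W(ωₙ,e)[(W′(u)(eu+ω²) + W(u)e)/((ω²+e²)(ω²+u²)) − W(u)(eu+ω²)·2u/((ω²+e²)(ω²+u²)²)]`. -/
def ppTrueKernelDu (β Λ e u : ℝ) : ℝ :=
  2 / β * ∑' n : ℕ, uvWeightFn Λ (ppFreq β n) e *
    ((uvWeightFnD1 Λ (ppFreq β n) u * (e * u + ppFreq β n ^ 2) + uvWeightFn Λ (ppFreq β n) u * e) / ((ppFreq β n ^ 2 + e ^ 2) * (ppFreq β n ^ 2 + u ^ 2)) -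
      uvWeightFn Λ (ppFreq β n) u * (e * u + ppFreq β n ^ 2) * (2 * u) / ((ppFreq β n ^ 2 + e ^ 2) * (ppFreq β n ^ 2 + u ^ 2) ^ 2))

/-- The uniform dominator of `∂ᵤP`'s summand: `(8B₁/Λ + 5β/(2π))/ωₙ²`. [folklore] -/
theorem abs_ppTrueKernelDu_summand_le {β Λ : ℝ} (hβ : 0 < β) (hΛ : 0 < Λ) {B₁ : ℝ} (hB₁ : ∀ x, |deriv salmhoferCutoff x| ≤ B₁) (e u : ℝ) (n : ℕ) :
    |uvWeightFn Λ (ppFreq β n) e *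
      ((uvWeightFnD1 Λ (ppFreq β n) u * (e * u + ppFreq β n ^ 2) + uvWeightFn Λ (ppFreq β n) u * e) / ((ppFreq β n ^ 2 + e ^ 2) * (ppFreq β n ^ 2 + u ^ 2)) -
        uvWeightFn Λ (ppFreq β n) u * (e * u + ppFreq β n ^ 2) * (2 * u) / ((ppFreq β n ^ 2 + e ^ 2) * (ppFreq β n ^ 2 + u ^ 2) ^ 2))| ≤
      (8 * B₁ / Λ + 5 / 2 * (β / π)) * (1 / (ppFreq β n ^ 2 + 0 ^ 2)) := by
  have hB0 := salmhoferB₁_nonneg hB₁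
  set ω := ppFreq β n with hωdef
  have hω : 0 < ω := ppFreq_pos hβ n
  have hq : 1 / ω ≤ β / π := inv_ppFreq_le hβ n
  have h1 : 0 < ω ^ 2 + e ^ 2 := by positivity
  have h2 : 0 < ω ^ 2 + u ^ 2 := by positivity
  have hcore := abs_pairSummand_core_le hω.ne' e u
  have hcore' : |(e * u + ω ^ 2) / ((ω ^ 2 + e ^ 2) * (ω ^ 2 + u ^ 2))| ≤ 2 / ω ^ 2 := by
    refine hcore.trans ?_
    have ha : 1 / (ω ^ 2 + u ^ 2) ≤ 1 / ω ^ 2 := one_div_le_one_div_of_le (by positivity) (by nlinarith [sq_nonneg u])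
    have hb : 1 / (ω ^ 2 + e ^ 2) ≤ 1 / ω ^ 2 := one_div_le_one_div_of_le (by positivity) (by nlinarith [sq_nonneg e])
    calc _ ≤ 1 / ω ^ 2 + 1 / ω ^ 2 := add_le_add ha hb
      _ = 2 / ω ^ 2 := by ring
  have hWe : |uvWeightFn Λ ω e| ≤ 1 := abs_uvWeightFn_le_one _ _ _
  have hWu : |uvWeightFn Λ ω u| ≤ 1 := abs_uvWeightFn_le_one _ _ _
  have hD1 : |uvWeightFnD1 Λ ω u| ≤ 4 * B₁ / Λ := by
    refine (abs_uvWeightFnD1_le_shell hB₁ hΛ ω u).trans ?_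
    have : 2 * Λ ^ 2 / (ω ^ 2 + Λ ^ 2) ≤ 2 := by rw [div_le_iff₀ (by positivity)]; nlinarith
    calc 2 * B₁ / Λ * (2 * Λ ^ 2 / (ω ^ 2 + Λ ^ 2)) ≤ 2 * B₁ / Λ * 2 := mul_le_mul_of_nonneg_left this (by positivity)
      _ = 4 * B₁ / Λ := by ring
  -- term A: `W′(u)(eu+ω²)/(…)`
  have hA : |uvWeightFnD1 Λ ω u * (e * u + ω ^ 2) / ((ω ^ 2 + e ^ 2) * (ω ^ 2 + u ^ 2))| ≤ 4 * B₁ / Λ * (2 / ω ^ 2) := by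
    rw [mul_div_assoc, abs_mul]; exact mul_le_mul hD1 hcore' (abs_nonneg _) (by positivity)
  -- term B: `W(u)·e/((ω²+e²)(ω²+u²))`
  have hB : |uvWeightFn Λ ω u * e / ((ω ^ 2 + e ^ 2) * (ω ^ 2 + u ^ 2))| ≤ 1 / (2 * ω) * (1 / ω ^ 2) := by
    have hLe := abs_lorentzian_le_half_inv hω e
    have hiu : |1 / (ω ^ 2 + u ^ 2)| ≤ 1 / ω ^ 2 := by
      rw [abs_of_pos (by positivity)]; exact one_div_le_one_div_of_le (by positivity) (by nlinarith [sq_nonneg u])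
    rw [show uvWeightFn Λ ω u * e / ((ω ^ 2 + e ^ 2) * (ω ^ 2 + u ^ 2)) = uvWeightFn Λ ω u * (e / (ω ^ 2 + e ^ 2)) * (1 / (ω ^ 2 + u ^ 2)) by
      field_simp, abs_mul, abs_mul]
    calc |uvWeightFn Λ ω u| * |e / (ω ^ 2 + e ^ 2)| * |1 / (ω ^ 2 + u ^ 2)| ≤ 1 * (1 / (2 * ω)) * (1 / ω ^ 2) := by gcongr
      _ = _ := by ring
  -- term C: `W(u)(eu+ω²)·2u/((ω²+e²)(ω²+u²)²)`
  have hC : |uvWeightFn Λ ω u * (e * u + ω ^ 2) * (2 * u) / ((ω ^ 2 + e ^ 2) * (ω ^ 2 + u ^ 2) ^ 2)| ≤ 1 * (2 / ω ^ 2) * (1 / ω) := by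
    have hLu := abs_lorentzian_le_half_inv hω u
    have h2u : |2 * u / (ω ^ 2 + u ^ 2)| ≤ 1 / ω := by
      rw [show 2 * u / (ω ^ 2 + u ^ 2) = 2 * (u / (ω ^ 2 + u ^ 2)) by ring, abs_mul, abs_of_pos (by norm_num : (0 : ℝ) < 2)]
      calc 2 * |u / (ω ^ 2 + u ^ 2)| ≤ 2 * (1 / (2 * ω)) := by gcongr
        _ = 1 / ω := by field_simp
    rw [show uvWeightFn Λ ω u * (e * u + ω ^ 2) * (2 * u) / ((ω ^ 2 + e ^ 2) * (ω ^ 2 + u ^ 2) ^ 2) =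
        uvWeightFn Λ ω u * ((e * u + ω ^ 2) / ((ω ^ 2 + e ^ 2) * (ω ^ 2 + u ^ 2))) * (2 * u / (ω ^ 2 + u ^ 2)) by field_simp, abs_mul, abs_mul]
    gcongr
  -- assemble
  rw [abs_mul]
  have hsum : |(uvWeightFnD1 Λ ω u * (e * u + ω ^ 2) + uvWeightFn Λ ω u * e) / ((ω ^ 2 + e ^ 2) * (ω ^ 2 + u ^ 2)) -
      uvWeightFn Λ ω u * (e * u + ω ^ 2) * (2 * u) / ((ω ^ 2 + e ^ 2) * (ω ^ 2 + u ^ 2) ^ 2)| ≤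
        4 * B₁ / Λ * (2 / ω ^ 2) + 1 / (2 * ω) * (1 / ω ^ 2) + 1 * (2 / ω ^ 2) * (1 / ω) := by
    rw [add_div]
    exact (abs_sub _ _).trans (add_le_add ((abs_add_le _ _).trans (add_le_add hA hB)) hC)
  calc |uvWeightFn Λ ω e| * |(uvWeightFnD1 Λ ω u * (e * u + ω ^ 2) + uvWeightFn Λ ω u * e) / ((ω ^ 2 + e ^ 2) * (ω ^ 2 + u ^ 2)) -
        uvWeightFn Λ ω u * (e * u + ω ^ 2) * (2 * u) / ((ω ^ 2 + e ^ 2) * (ω ^ 2 + u ^ 2) ^ 2)|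
      ≤ 1 * (4 * B₁ / Λ * (2 / ω ^ 2) + 1 / (2 * ω) * (1 / ω ^ 2) + 1 * (2 / ω ^ 2) * (1 / ω)) := mul_le_mul hWe hsum (abs_nonneg _) zero_le_one
    _ = (8 * B₁ / Λ + 5 / 2 * (1 / ω)) * (1 / (ω ^ 2 + 0 ^ 2)) := by field_simp; ring
    _ ≤ (8 * B₁ / Λ + 5 / 2 * (β / π)) * (1 / (ω ^ 2 + 0 ^ 2)) := by gcongr

/-- **`∂ᵤP` exists everywhere and is `ppTrueKernelDu`** (termwise differentiation). [cite: BenfattoGiulianiMastropietro2006, §2.4 (2.36)] -/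
theorem hasDerivAt_ppTrueKernel_u {β Λ : ℝ} (hβ : 0 < β) (hΛ : 0 < Λ) {B₁ : ℝ} (hB₁ : ∀ x, |deriv salmhoferCutoff x| ≤ B₁) (e u : ℝ) :
    HasDerivAt (fun v => ppTrueKernel β Λ e v) (ppTrueKernelDu β Λ e u) u := by
  unfold ppTrueKernel ppTrueKernelDu
  refine HasDerivAt.const_mul (2 / β) ?_
  refine hasDerivAt_tsum (u := fun n : ℕ => (8 * B₁ / Λ + 5 / 2 * (β / π)) * (1 / (ppFreq β n ^ 2 + 0 ^ 2)))
    (g := fun (n : ℕ) (v : ℝ) => uvWeightFn Λ (ppFreq β n) e * uvWeightFn Λ (ppFreq β n) v *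
      ((e * v + ppFreq β n ^ 2) / ((ppFreq β n ^ 2 + e ^ 2) * (ppFreq β n ^ 2 + v ^ 2))))
    (g' := fun (n : ℕ) (v : ℝ) => uvWeightFn Λ (ppFreq β n) e *
      ((uvWeightFnD1 Λ (ppFreq β n) v * (e * v + ppFreq β n ^ 2) + uvWeightFn Λ (ppFreq β n) v * e) / ((ppFreq β n ^ 2 + e ^ 2) * (ppFreq β n ^ 2 + v ^ 2)) -
        uvWeightFn Λ (ppFreq β n) v * (e * v + ppFreq β n ^ 2) * (2 * v) / ((ppFreq β n ^ 2 + e ^ 2) * (ppFreq β n ^ 2 + v ^ 2) ^ 2)))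
    ((summable_one_div_ppFreq_sq_add_sq hβ 0).mul_left _) (fun n v => ?_) (fun n v => ?_) (y₀ := u) (summable_ppTrueKernel hβ Λ e u) u
  · -- termwise derivative: `W(v)·(ev+ω²)/((ω²+e²)(ω²+v²))`
    have hω := ppFreq_pos hβ n
    have h1 : (ppFreq β n ^ 2 + e ^ 2) ≠ 0 := by positivity
    have h2 : (ppFreq β n ^ 2 + v ^ 2) ≠ 0 := by positivity
    have hW : HasDerivAt (fun y => uvWeightFn Λ (ppFreq β n) y) (uvWeightFnD1 Λ (ppFreq β n) v) v := hasDerivAt_uvWeightFn Λ (ppFreq β n) v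
    have hN : HasDerivAt (fun y : ℝ => e * y + ppFreq β n ^ 2) e v := by
      simpa using ((hasDerivAt_id v).const_mul e).add_const (ppFreq β n ^ 2)
    have hD : HasDerivAt (fun y : ℝ => (ppFreq β n ^ 2 + e ^ 2) * (ppFreq β n ^ 2 + y ^ 2)) ((ppFreq β n ^ 2 + e ^ 2) * (2 * v)) v := by
      have h0 := ((hasDerivAt_pow 2 v).const_add (ppFreq β n ^ 2)).const_mul (ppFreq β n ^ 2 + e ^ 2)
      refine h0.congr_deriv ?_
      simp
    have hQ := hN.div hD (mul_ne_zero h1 h2)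
    have h := (hW.fun_mul hQ).const_mul (uvWeightFn Λ (ppFreq β n) e)
    refine (h.congr_of_eventuallyEq (Eventually.of_forall fun y => by simp only [Pi.div_apply]; ring)).congr_deriv ?_
    simp only [Pi.div_apply]
    field_simp
    ring
  · rw [Real.norm_eq_abs]; exact abs_ppTrueKernelDu_summand_le hβ hΛ hB₁ e v n

/-- `u ↦ ∂ᵤP(e,u)` is continuous. [cite: BenfattoGiulianiMastropietro2006, §2.4 (2.36)] -/
theorem continuous_ppTrueKernelDu_u {β Λ : ℝ} (hβ : 0 < β) (hΛ : 0 < Λ) {B₁ : ℝ} (hB₁ : ∀ x, |deriv salmhoferCutoff x| ≤ B₁) (e : ℝ) :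
    Continuous fun u : ℝ => ppTrueKernelDu β Λ e u := by
  unfold ppTrueKernelDu
  refine continuous_const.mul ?_
  refine continuous_tsum (fun n => ?_) ((summable_one_div_ppFreq_sq_add_sq hβ 0).mul_left (8 * B₁ / Λ + 5 / 2 * (β / π))) fun n u => ?_
  · have hω := ppFreq_pos hβ n
    have hW : Continuous fun u : ℝ => uvWeightFn Λ (ppFreq β n) u := continuous_uvWeightFn_level Λ _
    have hW1 : Continuous fun u : ℝ => uvWeightFnD1 Λ (ppFreq β n) u := continuous_uvWeightFnD1_level Λ _
    have hne1 : ∀ u : ℝ, (ppFreq β n ^ 2 + e ^ 2) * (ppFreq β n ^ 2 + u ^ 2) ≠ 0 := fun u => by positivity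
    have hne2 : ∀ u : ℝ, (ppFreq β n ^ 2 + e ^ 2) * (ppFreq β n ^ 2 + u ^ 2) ^ 2 ≠ 0 := fun u => by positivity
    have hA : Continuous fun u : ℝ => (uvWeightFnD1 Λ (ppFreq β n) u * (e * u + ppFreq β n ^ 2) + uvWeightFn Λ (ppFreq β n) u * e) /
        ((ppFreq β n ^ 2 + e ^ 2) * (ppFreq β n ^ 2 + u ^ 2)) :=
      Continuous.div ((hW1.mul (by fun_prop)).add (hW.mul continuous_const)) (by fun_prop) hne1
    have hB : Continuous fun u : ℝ => uvWeightFn Λ (ppFreq β n) u * (e * u + ppFreq β n ^ 2) * (2 * u) /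
        ((ppFreq β n ^ 2 + e ^ 2) * (ppFreq β n ^ 2 + u ^ 2) ^ 2) :=
      Continuous.div ((hW.mul (by fun_prop)).mul (by fun_prop)) (by fun_prop) hne2
    have h : Continuous fun u : ℝ => uvWeightFn Λ (ppFreq β n) e *
        ((uvWeightFnD1 Λ (ppFreq β n) u * (e * u + ppFreq β n ^ 2) + uvWeightFn Λ (ppFreq β n) u * e) / ((ppFreq β n ^ 2 + e ^ 2) * (ppFreq β n ^ 2 + u ^ 2)) -
          uvWeightFn Λ (ppFreq β n) u * (e * u + ppFreq β n ^ 2) * (2 * u) / ((ppFreq β n ^ 2 + e ^ 2) * (ppFreq β n ^ 2 + u ^ 2) ^ 2)) :=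
      continuous_const.mul (hA.sub hB)
    exact h
  · rw [Real.norm_eq_abs]; exact abs_ppTrueKernelDu_summand_le hβ hΛ hB₁ e u n

/-- **`u ↦ P(e,u)` is `C¹`** — the (U1)-LAWS hypothesis `hK` for the true kernel. [cite: BenfattoGiulianiMastropietro2006, §2.4 (2.36)] -/
theorem contDiff_one_ppTrueKernel {β Λ : ℝ} (hβ : 0 < β) (hΛ : 0 < Λ) {B₁ : ℝ} (hB₁ : ∀ x, |deriv salmhoferCutoff x| ≤ B₁) (e : ℝ) :
    ContDiff ℝ 1 (fun u : ℝ => ppTrueKernel β Λ e u) := by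
  have hd : deriv (fun u : ℝ => ppTrueKernel β Λ e u) = fun u => ppTrueKernelDu β Λ e u := funext fun u => (hasDerivAt_ppTrueKernel_u hβ hΛ hB₁ e u).deriv
  rw [contDiff_one_iff_deriv, hd]
  exact ⟨fun u => (hasDerivAt_ppTrueKernel_u hβ hΛ hB₁ e u).differentiableAt, continuous_ppTrueKernelDu_u hβ hΛ hB₁ e⟩

/-- Off the anti-diagonal `∂ᵤP = ∂ᵤN/(e+u) − N/(e+u)²`. [cite: BenfattoGiulianiMastropietro2006, §2.4 (2.36)] -/
theorem ppTrueKernelDu_eq_of_ne {β Λ : ℝ} (hβ : 0 < β) (hΛ : 0 < Λ) {B₁ : ℝ} (hB₁ : ∀ x, |deriv salmhoferCutoff x| ≤ B₁) {e u : ℝ} (hs : e + u ≠ 0) :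
    ppTrueKernelDu β Λ e u = ppTrueNumeratorDu β Λ e u / (e + u) - ppTrueNumerator β Λ e u / (e + u) ^ 2 := by
  have h1 := hasDerivAt_ppTrueKernel_u hβ hΛ hB₁ e u
  have h2 := hasDerivAt_trueKernel_signed hβ hΛ hB₁ hs
  -- `P = N/(e+·)` near `u`
  have hev : (fun v : ℝ => ppTrueKernel β Λ e v) =ᶠ[𝓝 u] fun v => ppTrueNumerator β Λ e v / (e + v) := by
    have ho : IsOpen {v : ℝ | e + v ≠ 0} := isOpen_ne_fun (continuous_const.add continuous_id) continuous_const
    filter_upwards [ho.mem_nhds hs] with v hv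
    exact ppTrueKernel_eq_div hβ Λ hv
  exact h1.unique (h2.congr_of_eventuallyEq hev)

/-! ## §3 The envelopes at every signed partner level -/

/-- **`hK0` for the product form**: `0 < e` ⟹ `|P(e,u)| ≤ (12B₁+9)·(max e |u|)⁻¹` for EVERY `u ∈ ℝ`. [cite: BenfattoGiulianiMastropietro2006, §2.4 (2.36)] -/
theorem abs_ppTrueKernel_le_inv_max {β Λ : ℝ} (hβ : 0 < β) (hΛ : 0 < Λ) {B₁ : ℝ} (hB₁ : ∀ x, |deriv salmhoferCutoff x| ≤ B₁) {e : ℝ} (he : 0 < e) (u : ℝ) :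
    |ppTrueKernel β Λ e u| ≤ (12 * B₁ + 9) * (max e |u|)⁻¹ := by
  -- both sides are continuous in `u`; the bound holds off `u = −e`
  have hoff : ∀ v : ℝ, e + v ≠ 0 → |ppTrueKernel β Λ e v| ≤ (12 * B₁ + 9) * (max e |v|)⁻¹ := fun v hv => by
    rw [ppTrueKernel_eq_div hβ Λ hv]; exact abs_trueKernel_signed_le_inv_max hβ hΛ hB₁ he v
  rcases ne_or_eq (e + u) 0 with hs | hs
  · exact hoff u hs
  · have hu : u = -e := by linarith
    have hf : Continuous fun v : ℝ => |ppTrueKernel β Λ e v| := (continuous_ppTrueKernel_u hβ Λ e).abs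
    have hg : ContinuousAt (fun v : ℝ => (12 * B₁ + 9) * (max e |v|)⁻¹) u :=
      (continuousAt_const.mul ((continuous_const.max continuous_abs).continuousAt.inv₀ (by have := le_max_left e |u|; positivity)))
    have hev : ∀ᶠ v in 𝓝[≠] u, |ppTrueKernel β Λ e v| ≤ (12 * B₁ + 9) * (max e |v|)⁻¹ := by
      filter_upwards [self_mem_nhdsWithin] with v hv
      have hvu : v ≠ u := hv
      exact hoff v (by intro h0; exact hvu (by rw [hu]; linarith))
    exact le_of_tendsto_of_tendsto (hf.continuousAt.tendsto.mono_left nhdsWithin_le_nhds) (hg.tendsto.mono_left nhdsWithin_le_nhds) hev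

/-- **`hK1` for the product form on the split's support**: `0 < e`, `0 < c ≤ 1`, `c·e ≤ |u|` ⟹ `|∂ᵤP(e,u)| ≤ (64B₂+96B₁+136+(12B₁+9)/c)·(max e |u|)⁻¹²`
for EVERY such `u` (the point `u = −e` by continuity from the left). [cite: BenfattoGiulianiMastropietro2006, §2.4 (2.36)] -/
theorem abs_ppTrueKernelDu_le_inv_max_sq {β Λ : ℝ} (hβ : 0 < β) (hΛ : 0 < Λ) {B₁ B₂ : ℝ} (hB₁ : ∀ x, |deriv salmhoferCutoff x| ≤ B₁)
    (hB₂ : ∀ x, |deriv (deriv salmhoferCutoff) x| ≤ B₂) {c e u : ℝ} (hc : 0 < c) (hc1 : c ≤ 1) (he : 0 < e) (hsupp : c * e ≤ |u|) :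
    |ppTrueKernelDu β Λ e u| ≤ (64 * B₂ + 96 * B₁ + 136 + (12 * B₁ + 9) / c) * (max e |u|)⁻¹ ^ 2 := by
  have hoff : ∀ v : ℝ, e + v ≠ 0 → c * e ≤ |v| → |ppTrueKernelDu β Λ e v| ≤ (64 * B₂ + 96 * B₁ + 136 + (12 * B₁ + 9) / c) * (max e |v|)⁻¹ ^ 2 :=
    fun v hv hsv => by
      rw [ppTrueKernelDu_eq_of_ne hβ hΛ hB₁ hv]; exact abs_trueKernelDu_signed_le_inv_max_sq hβ hΛ hB₁ hB₂ hc hc1 he hv hsv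
  rcases ne_or_eq (e + u) 0 with hs | hs
  · exact hoff u hs hsupp
  · have hu : u = -e := by linarith
    have hf : Continuous fun v : ℝ => |ppTrueKernelDu β Λ e v| := (continuous_ppTrueKernelDu_u hβ hΛ hB₁ e).abs
    have hg : ContinuousAt (fun v : ℝ => (64 * B₂ + 96 * B₁ + 136 + (12 * B₁ + 9) / c) * (max e |v|)⁻¹ ^ 2) u :=
      continuousAt_const.mul (((continuous_const.max continuous_abs).continuousAt.inv₀ (by have := le_max_left e |u|; positivity)).pow 2)
    -- from the left of `−e` the levels satisfy `|v| > e ≥ c·e` and `e + v ≠ 0`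
    have hev : ∀ᶠ v in 𝓝[<] u, |ppTrueKernelDu β Λ e v| ≤ (64 * B₂ + 96 * B₁ + 136 + (12 * B₁ + 9) / c) * (max e |v|)⁻¹ ^ 2 := by
      filter_upwards [self_mem_nhdsWithin] with v hv
      have hv' : v < -e := by rw [hu] at hv; exact hv
      refine hoff v (by linarith) ?_
      rw [abs_of_neg (by linarith)]; nlinarith
    exact le_of_tendsto_of_tendsto (hf.continuousAt.tendsto.mono_left nhdsWithin_le_nhds) (hg.tendsto.mono_left nhdsWithin_le_nhds) hev

end Summit.HubbardSuperconductivity.HubbardSuperconductivity.Theorems.C4a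

end
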